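import Summits.ResolutionOfSingularities.ResolutionOfSingularities.Theorems.WeightedInvariantHypersurfaceLocalGameEFTPointMoveChart
import Summits.ResolutionOfSingularities.ResolutionOfSingularities.Theorems.WeightedInvariantWeightedInitialFormOrder
import HarnessLib

/-!
# «ν does not rise under an admissible weighted move» — the order of the saturated transform at EVERY successor point
# is at most the degree of a unit monomial of the weighted initial form (ORDER (o33-a), point / flag centres)

Topic: `Summits/ResolutionOfSingularities/ResolutionOfSingularities/Theorems`. Helper for the door item
`HypersurfaceCentreConstruction` (statement `stmt-ResolutionOfSingularities-19897`, route `WeightedInvariant`), line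
`local-engine` of res-L1-w43-plan-1 (L W4.3), ORDER (o33-a) of `IOTA3-DESIGN.md` v1 §5 («the ν-half of (drop) in all
regimes»), part 2/2 — the position-level statement for moves whose weights are ALL POSITIVE (point centres and flag
centres: regime P3b, the E8/E1/E2 rows; the cylinder regime P3a, where some parameters carry weight `0`, needs the
exceptional-chart map `rho` for a PARTIAL system of parameters and is not covered here).

**Theorem (`adicOrder_transform_le_of_isUnit_coeff`).** Let `S` be a regular local ring, `u : Fin d → S` a regular
system of parameters (`(u) = 𝔪`, `embdim S = d`), `w` positive weights, and
`f = Σ_{β ∈ Δ} a_β u^β + r` with `r ∈ 𝔪^N`, `ℓ ≤ w·β` on `Δ`, `ℓ < N` (so `f ∈ 𝒥_ℓ = weightedMonomialIdeal u w ℓ`), such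
that SOME `α ∈ Δ` of weight exactly `w·α = ℓ` carries a UNIT coefficient `a_α` («the weighted initial form of `f`
contains the monomial `u^α` with a unit coefficient»).  Then for every prime `𝔫 ∋ t⁻¹` of the cobordant algebra
`B = S[t⁻¹, 𝒥ₙtⁿ]` and every factorisation `f = (t⁻¹)^a · g` in `B` with `t⁻¹ ∤ g`:
`ord_{B_𝔫}(g) ≤ |α| = Σ α_i` (`adicOrder`, and `iotaOrd` in `iotaOrd_transform_le_of_isUnit_coeff`).
With `|α| = ν = ord_𝔪 f` this is plan-1's «ν does not rise»; NO vertex exclusion and no `𝔫 ⊇ 𝔪B` is needed.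

Proof.  By res-type-098's K3a (`…EFTPointMoveChart`, p507345): `g` is the saturated transform `G` and its image under
the exceptional chart `rho : B → B/(t⁻¹) ≅ κ[X₁,…,X_d]` (`κ = S/𝔪`) is the face polynomial
`Φ = Σ_{w·β = ℓ} ā_β X^β`, weighted-homogeneous of weight `ℓ` with the unit coefficient `ā_α` at `X^α`; the local
homomorphism `B_𝔫 → κ[X]_{rho(𝔫)}` does not decrease orders (`adicOrder_le_adicOrder_map`), and
`ord_{rho(𝔫)} Φ ≤ |α|` is part 1 (`WeightedInitialFormOrder.adicOrder_le_degree_of_isUnit_coeff`: the Hasse derivative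
`D^{(α)} Φ` is the unit `ā_α`).

TRAP recorded by the planner (why the unit-monomial hypothesis is there): `x² + y²z⁵` with the weights `(5, 1)` on
`(x, y)` and level `ℓ = 2` has `a = 2`, `g = T⁸x′² + y′²z⁵` of order `5 > 2 = ν` at the point `y′ = 1` — here `x²` has
weight `10 ≠ ℓ` and `y²z⁵` has degree `7 ≠ ν`, so no monomial of `f` has both weight `ℓ` and degree `ν`.

[OURS · L1 W4.3] Replaces the role of NO printed item; NOT a statement of the manuscript
[claim: Hironaka2017, status: under-review]. AI work, weaker than expert review. For ordinary blow-ups (all weights `1`,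
`ℓ = ν`) this is the classical «the multiplicity of a point of the projectivised tangent cone is at most the
multiplicity»; for weighted moves it is the planner's candidate, here proved.

## References

* J. Włodarczyk, *Functorial resolution by torus actions*, arXiv:2203.03090, §2.3.9, Lemma 4.1.7 (exceptional divisor
  of the full cobordant blow-up, initial forms). [Wlodarczyk2022]
* A. Grothendieck, ÉGA IV₄ §16.8, Thm. 16.11.2 (Hasse–Schmidt operators `D_p`). [EGAIV4]
* res-L1-w43-plan-1, `L/res-L1-w43-plan-1/IOTA3-DESIGN.md` v1 §5 ORDER (o33-a) (OURS, AI planning).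
-/

noncomputable section

open IsLocalRing MvPolynomial Literature.AlgebraicGeometry.Resolution
open Summit.ResolutionOfSingularities.ResolutionOfSingularities.Cruxes.HypersurfaceCentreConstruction.LocalEngine
  (iotaOrd iotaOrd_eq_ordOfENat_adicOrder ordOfENat ordOfENat_natCast ordOfENat_strictMono)
open Summit.ResolutionOfSingularities.ResolutionOfSingularities.Theorems.LocalGameEFTPointMove
open Summit.ResolutionOfSingularities.ResolutionOfSingularities.Theorems.WeightedInitialFormOrder

set_option linter.dupNamespace false -- mandated namespace of this single-conjunct summit

namespace Summit.ResolutionOfSingularities.ResolutionOfSingularities.Theorems.OrderNonIncrease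

variable {S : Type} [CommRing S] {d : ℕ}

/-! ## The face polynomial: weighted homogeneity and its coefficients -/

/-- `C c · ∏ X_i^{β_i}` is the monomial `c X^β`. [folklore] -/
theorem C_mul_prod_X_pow_eq_monomial {R : Type*} [CommSemiring R] (c : R) (β : Fin d → ℕ) :
    C c * ∏ i, X i ^ β i = monomial (Finsupp.equivFunOnFinite.symm β) c := by
  rw [monomial_eq, Finsupp.prod_fintype _ _ (fun i => pow_zero _)]
  simp

/-- The weight of `X^β` is `Σ w_i β_i`. [folklore] -/
theorem weight_equivFunOnFinite_symm (w : Fin d → ℕ) (β : Fin d → ℕ) :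
    Finsupp.weight w (Finsupp.equivFunOnFinite.symm β) = ∑ i, w i * β i := by
  rw [Finsupp.weight_apply, Finsupp.sum_fintype _ _ (fun i => by simp)]
  simp [mul_comm]

/-- The degree of `X^β` is `Σ β_i`. [folklore] -/
theorem degree_equivFunOnFinite_symm (β : Fin d → ℕ) :
    (Finsupp.equivFunOnFinite.symm β).degree = ∑ i, β i := by
  rw [Finsupp.degree_eq_sum]
  simp

/-- **The face polynomial `Σ_{β ∈ Δ, w·β = m} c_β X^β` is weighted-homogeneous of weight `m`.** [folklore] -/
theorem face_isWeightedHomogeneous {R : Type*} [CommRing R] (w : Fin d → ℕ) (Δ : Finset (Fin d → ℕ))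
    (c : (Fin d → ℕ) → R) (m : ℕ) :
    IsWeightedHomogeneous w
      (∑ β ∈ Δ.filter (fun β : Fin d → ℕ => ∑ i, w i * β i = m),
        (C (c β) * ∏ i, X i ^ β i : MvPolynomial (Fin d) R)) m := by
  refine IsWeightedHomogeneous.sum _ _ _ fun β hβ => ?_
  rw [C_mul_prod_X_pow_eq_monomial]
  refine isWeightedHomogeneous_monomial w _ _ ?_
  rw [weight_equivFunOnFinite_symm]
  exact (Finset.mem_filter.mp hβ).2

/-- **The coefficient of `X^α` in the face polynomial is `c_α`** (for `α ∈ Δ` of weight `m`). [folklore] -/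
theorem coeff_face {R : Type*} [CommRing R] (w : Fin d → ℕ) (Δ : Finset (Fin d → ℕ)) (c : (Fin d → ℕ) → R)
    (m : ℕ) {α : Fin d → ℕ} (hα : α ∈ Δ) (hwα : ∑ i, w i * α i = m) :
    coeff (Finsupp.equivFunOnFinite.symm α)
      (∑ β ∈ Δ.filter (fun β : Fin d → ℕ => ∑ i, w i * β i = m),
        (C (c β) * ∏ i, X i ^ β i : MvPolynomial (Fin d) R)) = c α := by
  rw [coeff_sum, Finset.sum_eq_single α]
  · rw [C_mul_prod_X_pow_eq_monomial, coeff_monomial, if_pos rfl]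
  · intro β _ hne
    rw [C_mul_prod_X_pow_eq_monomial, coeff_monomial, if_neg]
    exact fun h => hne (Finsupp.equivFunOnFinite.symm.injective h)
  · intro h
    exact absurd (Finset.mem_filter.mpr ⟨hα, hwα⟩) h

/-! ## The order of the saturated transform at every successor point -/

section Successor

variable [IsRegularLocalRing S] (u : Fin d → S) (w : Fin d → ℕ) (hu : Ideal.span (Set.range u) = maximalIdeal S)
  (hd : (maximalIdeal S).spanFinrank = d) (hw : ∀ i, 0 < w i)

include hu hd hw

/-- **(o33-a) «ν does not rise», `adicOrder` form.**  `S` regular local, `u` a regular system of parameters with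
positive weights `w`, `f = Σ_{β∈Δ} a_β u^β + r`, `r ∈ 𝔪^N`, `ℓ ≤ w·β` on `Δ`, `ℓ < N`, and some `α ∈ Δ` with `w·α = ℓ` and
`a_α` a UNIT.  Then at every prime `𝔫 ∋ t⁻¹` of the cobordant algebra and for every factorisation `f = (t⁻¹)^a g`,
`t⁻¹ ∤ g`: `ord_{B_𝔫} g ≤ Σ α_i`. [OURS · L1 W4.3 · ORDER (o33-a)] [cite: Wlodarczyk2022, Lemma 4.1.7] -/
theorem adicOrder_transform_le_of_isUnit_coeff (Δ : Finset (Fin d → ℕ)) (a : (Fin d → ℕ) → S) (ℓ : ℕ)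
    {N : ℕ} (hN : 0 < N) {r : S} (hr : r ∈ (maximalIdeal S) ^ N) (hm : ∀ β ∈ Δ, ℓ ≤ ∑ i, w i * β i)
    (hℓN : ℓ < N) {f : S} (hf : f = ∑ β ∈ Δ, a β * ∏ i, u i ^ β i + r)
    {α : Fin d → ℕ} (hα : α ∈ Δ) (hwα : ∑ i, w i * α i = ℓ) (hunit : IsUnit (a α))
    (𝔫 : Ideal (extReesAlgebra (weightedMonomialIdeal u w))) [𝔫.IsPrime]
    (hT : extReesAlgebra.tInv (weightedMonomialIdeal u w) ∈ 𝔫)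
    {a' : ℕ} {g : extReesAlgebra (weightedMonomialIdeal u w)}
    (hfg : algebraMap S (extReesAlgebra (weightedMonomialIdeal u w)) f =
      extReesAlgebra.tInv (weightedMonomialIdeal u w) ^ a' * g)
    (hndvd : ¬ extReesAlgebra.tInv (weightedMonomialIdeal u w) ∣ g) :
    adicOrder (algebraMap _ (Localization.AtPrime 𝔫) g) ≤ ((∑ i, α i : ℕ) : ℕ∞) := by
  classical
  -- the residue ring `S/(u) = S/𝔪` is non-trivial
  haveI : Nontrivial (S ⧸ Ideal.span (Set.range u)) :=
    Ideal.Quotient.nontrivial_iff.mpr (hu ▸ (maximalIdeal.isMaximal S).ne_top)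
  -- the face polynomial and its unit coefficient at `X^α`
  set Φ := rho u w hu hd hw (transform u w hu hw Δ a ℓ hN hr) with hΦdef
  have hΦeq := rho_transform u w hu hd hw Δ a ℓ hN hr hm hℓN
  have hcoeff : coeff (Finsupp.equivFunOnFinite.symm α) Φ = Ideal.Quotient.mk _ (a α) := by
    rw [hΦdef, hΦeq]
    exact coeff_face w Δ _ ℓ hα hwα
  have hunit' : IsUnit (coeff (Finsupp.equivFunOnFinite.symm α) Φ) := by
    rw [hcoeff]
    exact hunit.map _
  have hΦwh : Φ.IsWeightedHomogeneous w ℓ := by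
    rw [hΦdef, hΦeq]
    exact face_isWeightedHomogeneous w Δ _ ℓ
  have hΦ0 : Φ ≠ 0 := fun h => hunit'.ne_zero (by rw [h, MvPolynomial.coeff_zero])
  -- `g` is the saturated transform
  obtain ⟨-, rfl⟩ := transform_unique u w hu hd hw Δ a ℓ hN hr hm hℓN hf hΦ0 hfg hndvd
  -- the exceptional chart at `𝔫`
  haveI h𝔫' : (nbar u w hu hd hw 𝔫).IsPrime := nbar_isPrime u w hu hd hw 𝔫 hT
  have hcomap : 𝔫 = (nbar u w hu hd hw 𝔫).comap (rho u w hu hd hw) := (comap_rho_nbar u w hu hd hw 𝔫 hT).symm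
  set φ := Localization.localRingHom 𝔫 (nbar u w hu hd hw 𝔫) (rho u w hu hd hw) hcomap with hφ
  haveI : IsLocalHom φ := Localization.isLocalHom_localRingHom 𝔫 _ _ hcomap
  have h1 := adicOrder_le_adicOrder_map (R := Localization.AtPrime 𝔫)
    (S := Localization.AtPrime (nbar u w hu hd hw 𝔫)) φ
    (algebraMap _ (Localization.AtPrime 𝔫) (transform u w hu hw Δ a ℓ hN hr))
  rw [hφ, Localization.localRingHom_to_map] at h1
  refine h1.trans ?_
  have h2 := adicOrder_le_degree_of_isUnit_coeff hw hΦwh hunit' (nbar u w hu hd hw 𝔫)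
  rwa [degree_equivFunOnFinite_symm] at h2

/-- **(o33-a) «ν does not rise», `iotaOrd` form**: under the same hypotheses,
`iotaOrd (B_𝔫) g ≤ Σ α_i` — the ν-half of the (drop) conjunct, in the currency of the KEY's first letter.
[OURS · L1 W4.3 · ORDER (o33-a)] [cite: Wlodarczyk2022, Lemma 4.1.7] -/
theorem iotaOrd_transform_le_of_isUnit_coeff (Δ : Finset (Fin d → ℕ)) (a : (Fin d → ℕ) → S) (ℓ : ℕ)
    {N : ℕ} (hN : 0 < N) {r : S} (hr : r ∈ (maximalIdeal S) ^ N) (hm : ∀ β ∈ Δ, ℓ ≤ ∑ i, w i * β i)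
    (hℓN : ℓ < N) {f : S} (hf : f = ∑ β ∈ Δ, a β * ∏ i, u i ^ β i + r)
    {α : Fin d → ℕ} (hα : α ∈ Δ) (hwα : ∑ i, w i * α i = ℓ) (hunit : IsUnit (a α))
    (𝔫 : Ideal (extReesAlgebra (weightedMonomialIdeal u w))) [𝔫.IsPrime]
    (hT : extReesAlgebra.tInv (weightedMonomialIdeal u w) ∈ 𝔫)
    {a' : ℕ} {g : extReesAlgebra (weightedMonomialIdeal u w)}
    (hfg : algebraMap S (extReesAlgebra (weightedMonomialIdeal u w)) f =
      extReesAlgebra.tInv (weightedMonomialIdeal u w) ^ a' * g)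
    (hndvd : ¬ extReesAlgebra.tInv (weightedMonomialIdeal u w) ∣ g) :
    iotaOrd (Localization.AtPrime 𝔫) (algebraMap _ (Localization.AtPrime 𝔫) g) ≤ ((∑ i, α i : ℕ) : Ordinal) := by
  have h := adicOrder_transform_le_of_isUnit_coeff u w hu hd hw Δ a ℓ hN hr hm hℓN hf hα hwα hunit 𝔫 hT hfg hndvd
  rw [iotaOrd_eq_ordOfENat_adicOrder, ← ordOfENat_natCast]
  exact ordOfENat_strictMono.monotone h

end Successor

end Summit.ResolutionOfSingularities.ResolutionOfSingularities.Theorems.OrderNonIncrease
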